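import Literature.AlgebraicGeometry.HodgeTheory.WeilClassesFieldQuaternionMatricesDecomposable
import HarnessLib

/-!
# Moonen–Zarhin's Criterion (2), the type-1 row MADE EXPLICIT: an endomorphism of `A^{n+1}` whose matrix entries are
# polynomials in the real multiplication `ψ` lies (on `H¹`) in `ℂ⟨(⊕ψ)^*, (πₐ ≫ ι_b)^*⟩`, so its Weil classes are
# decomposable, hence algebraic; with «`End(A^{n+1}) = M_{n+1}(End A)`» in diagonals and matrix units
# (Moonen–Zarhin 1998 §1)

Layer `Literature/AlgebraicGeometry/HodgeTheory`; THEOREMS ONLY — no definition, no named fact, no `sorry` (D-0026, net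
debt 0).  Discharges the hypothesis `hF : φ^* ∈ ℂ⟨(⊕ψ)^*, (πₐ ≫ ι_b)^*⟩` of the seat's
`WeilClassesFieldRealMultiplicationMatricesDecomposable` from data on `End(A^{n+1})`: the matrix entries of `φ`.

## The print

B. J. J. Moonen, Yu. G. Zarhin, *Weil classes on abelian varieties*, J. reine angew. Math. 496 (1998) 83–92 =
arXiv:alg-geom/9612017 [MoonenZarhin1998WeilClasses] (held text `paper:arxiv-alg-geom_9612017`), §1 Table 1 (chunk
p0002 L60–L84): for `X = Y^m`, `End⁰(X) = M_m(End⁰ Y)`, Type 1: `B = M_m(E)`; §1 Criterion (2) and its proof (chunk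
p0003 L46–L90): «suppose that `F ⊆ B` … `G_div(X) ⊆ Sl_F(V_X)`, hence `G_div(X)` acts trivially on `W_F`».

## What is proved (`X = A^{n+1} = ⨁_{Fin (n+1)} A`, on `H¹(X(ℂ); ℂ)`; `e_{ab} = (πₐ ≫ ι_b)^*`)

* `pullbackOne_biproductMap_const_eq_aeval_of_eq_aeval` — `g^* = q(ψ^*) ⟹ (⊕g)^* = q((⊕ψ)^*)`;
  `pullbackOne_biproductMap_const_eval₂` — `(⊕ p(ψ))^* = p̄((⊕ψ)^*)` for `p ∈ ℤ[X]`.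
* **`eq_sum_biproductMap_entry_comp_π_comp_ι`** — `φ = Σ_{a,b} (⊕ φ_{ab}) ≫ (πₐ ≫ ι_b)`, `φ_{ab} = ιₐ ≫ φ ≫ π_b`;
  `pullbackOne_eq_sum_biproductMap_entry_mul_π_comp_ι` — `φ^* = Σ_{a,b} (⊕φ_{ab})^* e_{ab}`.
* **`pullbackOne_mem_adjoin_diagonal_of_entry_eq_eval₂`** — entries `φ_{ab} = p_{ab}(ψ)` ⟹ `φ^* ∈ ℂ⟨(⊕ψ)^*, e_{ab}⟩`.
* **`weilClassesField_biproduct_le_divisorClassesSpan_of_entry_eq_eval₂`**, **`…_le_algebraicClasses_of_entry_eq_eval₂`**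
  — the type-1 row of `WeilClassesFieldRealMultiplicationMatricesDecomposable` with `hF` replaced by the entries.

Scope (honest column).  Entries in `ℤ[ψ]` (integral polynomials): an `F`-generator with entries in `E = ℚ(ψ)` is
`N⁻¹ ×` such a `φ`, same field `F` — not restated.  The type-2 analogue (entries non-commutative polynomials in
`ψ, α, β`) is not written; `pullbackOne_eq_sum_biproductMap_entry_mul_π_comp_ι` is the entry point for it.

## References

* [MoonenZarhin1998WeilClasses] B. J. J. Moonen, Yu. G. Zarhin, Weil classes on abelian varieties, J. reine angew.
  Math. 496 (1998) 83–92; arXiv:alg-geom/9612017: §1 Table 1 (chunk p0002 L60–L84), Criterion (2) and its proof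
  (chunk p0003 L46–L90).
* [Milne1999LefschetzClasses] J. S. Milne, Lefschetz classes on abelian varieties, Duke Math. J. 96 (1999), §1 p. 643,
  Thm. 3.2, Cor. 4.5.
* [LangeBirkenhake1992] H. Lange, Ch. Birkenhake, Complex Abelian Varieties (1992), §1.1, §5.1.
* [McconnellRobson2001] J. C. McConnell, J. C. Robson, Noncommutative Noetherian Rings, GSM 30 (AMS 2001), 3.5.5–3.5.7.
* [VoisinHodgeI2002] C. Voisin, Hodge Theory and Complex Algebraic Geometry I (CUP 2002), Thm. 11.30.

## Provenance

Lane `lit-hodgefound` (Track 2, Layer A), prover seat `lit-hodgefound-p21` (generation 21), row g21-#6.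
-/

noncomputable section

open CategoryTheory CategoryTheory.Limits
open Literature.AlgebraicTopology.SingularHomology
open Literature.AlgebraicGeometry.Motives
open Literature.AlgebraicGeometry.VanGeemen1994 (hodgeClassSpan pullbackOne)
open Literature.AlgebraicGeometry.Milne1999
open Literature.AlgebraicGeometry.Pohlmann1968 (sum_map_π_map_ι map_biproductMap_map_π)
open Literature.Geometry.Kaehler (lefschetzPow)
open Literature.Barriers.HodgeConjecture (divisorClassesSpan)
open Literature.LinearAlgebra
open Polynomial

namespace Literature.AlgebraicGeometry.HodgeTheory

section MatrixEntries

variable {A : AbelianVariety ℂ} {h : complexBetti A.X 2} {n : ℕ} {ψ : A ⟶ A}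
  {φ : ⨁ (fun _ : Fin (n + 1) => A) ⟶ ⨁ (fun _ : Fin (n + 1) => A)} {P Q : Polynomial ℤ} {e m : ℕ}

/-- `L ∘ q(f) = q(g) ∘ L` when `L ∘ f = g ∘ L`. [folklore] -/
private theorem map_aeval_apply_of_semiconj' {M N : Type*} [AddCommGroup M] [Module ℂ M] [AddCommGroup N] [Module ℂ N]
    (L : M →ₗ[ℂ] N) (f : Module.End ℂ M) (g : Module.End ℂ N) (hc : ∀ v, L (f v) = g (L v)) (q : ℂ[X]) (v : M) :
    L (aeval f q v) = aeval g q (L v) := by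
  induction q using Polynomial.induction_on' generalizing v with
  | add p q hp hq => rw [map_add, map_add, LinearMap.add_apply, LinearMap.add_apply, map_add, hp, hq]
  | monomial k c =>
    rw [aeval_monomial, aeval_monomial, Module.End.mul_apply, Module.End.mul_apply,
      Module.algebraMap_end_apply, Module.algebraMap_end_apply, map_smul]
    congr 1
    induction k generalizing v with
    | zero => rw [pow_zero, pow_zero, Module.End.one_apply, Module.End.one_apply]
    | succ k ih => rw [pow_succ, pow_succ, Module.End.mul_apply, Module.End.mul_apply, ih, hc]

/-- `(f ≫ g)^* = f^* ∘ g^*` on `H¹`, in `Module.End`. [folklore] -/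
private theorem pullbackOne_comp_eq_mul' {Y : AbelianVariety ℂ} (f g : Y ⟶ Y) :
    pullbackOne Y (f ≫ g) = pullbackOne Y f * pullbackOne Y g := by
  change (complexBetti.map (f.hom.hom.hom ≫ g.hom.hom.hom) 1).hom = _
  rw [complexBetti.map_comp, ModuleCat.hom_comp]
  rfl

/-- `0^* = 0` on `H¹`. [folklore] -/
private theorem pullbackOne_zero'' {Y : AbelianVariety ℂ} : pullbackOne Y (0 : Y ⟶ Y) = 0 := by
  change (complexBetti.map (0 : Y ⟶ Y).hom.hom.hom 1).hom = 0
  rw [complexBetti_map_zero_one, ModuleCat.hom_zero]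

/-- `(f + g)^* = f^* + g^*` on `H¹`. [folklore] -/
private theorem pullbackOne_add'' {Y : AbelianVariety ℂ} (f g : Y ⟶ Y) :
    pullbackOne Y (f + g) = pullbackOne Y f + pullbackOne Y g := by
  change (complexBetti.map (f + g).hom.hom.hom 1).hom = _
  rw [complexBetti_map_add_one, ModuleCat.hom_add]

/-- Pull-back is additive over finite sums: `(Σ fⱼ)^* = Σ fⱼ^*` on `H¹`. [folklore] -/
private theorem pullbackOne_finset_sum {Y : AbelianVariety ℂ} {J : Type*} (s : Finset J) (f : J → (Y ⟶ Y)) :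
    pullbackOne Y (∑ j ∈ s, f j) = ∑ j ∈ s, pullbackOne Y (f j) := by
  classical
  induction s using Finset.induction_on with
  | empty => rw [Finset.sum_empty, Finset.sum_empty, pullbackOne_zero'']
  | insert a s ha ih => rw [Finset.sum_insert ha, Finset.sum_insert ha, pullbackOne_add'', ih]

/-- A polynomial relation `g^* = q(ψ^*)` on `H¹(A)` transfers to the diagonals of the power: `(⊕g)^* = q((⊕ψ)^*)` on
`H¹(A^{n+1})` (slot by slot, `πᵢ^*` intertwining `ψ^*` and `(⊕ψ)^*`). [cite: LangeBirkenhake1992, §1.1] [cite: Milne1999LefschetzClasses, §1 p. 643] -/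
theorem pullbackOne_biproductMap_const_eq_aeval_of_eq_aeval {g : A ⟶ A} {q : ℂ[X]}
    (hg : pullbackOne A g = aeval (pullbackOne A ψ) q) :
    pullbackOne (⨁ (fun _ : Fin (n + 1) => A)) (biproduct.map fun _ : Fin (n + 1) => g) =
      aeval (pullbackOne (⨁ (fun _ : Fin (n + 1) => A)) (biproduct.map fun _ : Fin (n + 1) => ψ)) q := by
  refine LinearMap.ext fun v ↦ ?_
  rw [pullbackOne_biproductMap_const_apply]
  conv_rhs => rw [← sum_map_π_map_ι (fun _ : Fin (n + 1) => A) v, map_sum]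
  refine Finset.sum_congr rfl fun c _ ↦ ?_
  rw [hg]
  exact map_aeval_apply_of_semiconj' (complexBetti.map (biproduct.π (fun _ : Fin (n + 1) => A) c).hom.hom.hom 1).hom
    (pullbackOne A ψ) _ (fun w ↦ (map_biproductMap_map_π (fun _ : Fin (n + 1) => A) (fun _ => ψ) c 1 w).symm) q _

/-- **`(⊕ p(ψ))^* = p̄((⊕ψ)^*)`**: the diagonal of a polynomial `p(ψ) ∈ ℤ[ψ] ⊆ End(A)` acts on `H¹(A^{n+1}(ℂ); ℂ)` as the
same polynomial (coefficients mapped to `ℂ`) of the diagonal `(⊕ψ)^*` — the scalars `E = ℚ(ψ) ⊆ M_{n+1}(E) = B`.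
[cite: MoonenZarhin1998WeilClasses, §1 Table 1 («Type 1: B = M_m(E)»; chunk p0002 L60–L84)] [cite: LangeBirkenhake1992, §1.1] -/
theorem pullbackOne_biproductMap_const_eval₂ (p : Polynomial ℤ) :
    pullbackOne (⨁ (fun _ : Fin (n + 1) => A))
        (biproduct.map fun _ : Fin (n + 1) =>
          (Polynomial.eval₂ (Int.castRingHom (CategoryTheory.End A)) (ψ : CategoryTheory.End A) p :)) =
      aeval (pullbackOne (⨁ (fun _ : Fin (n + 1) => A)) (biproduct.map fun _ : Fin (n + 1) => ψ))
        (p.map (Int.castRingHom ℂ)) :=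
  pullbackOne_biproductMap_const_eq_aeval_of_eq_aeval (hom_complexBetti_map_eval₂_one ψ p)

/-- **`End(A^{n+1}) = M_{n+1}(End A)`, written with diagonals and matrix units**: every endomorphism `φ` of the power is
`φ = Σ_{a,b} (⊕ φ_{ab}) ≫ (πₐ ≫ ι_b)` with entries `φ_{ab} = ιₐ ≫ φ ≫ π_b` (`biproduct.total` twice and
`map φ_{ab} ≫ πₐ = πₐ ≫ φ_{ab}`). [cite: LangeBirkenhake1992, §1.1] [cite: McconnellRobson2001, 3.5.5–3.5.6] -/
theorem eq_sum_biproductMap_entry_comp_π_comp_ι (φ : ⨁ (fun _ : Fin (n + 1) => A) ⟶ ⨁ (fun _ : Fin (n + 1) => A)) :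
    φ = ∑ ab : Fin (n + 1) × Fin (n + 1),
      (biproduct.map fun _ : Fin (n + 1) =>
          biproduct.ι (fun _ : Fin (n + 1) => A) ab.1 ≫ φ ≫ biproduct.π (fun _ : Fin (n + 1) => A) ab.2) ≫
        (biproduct.π (fun _ : Fin (n + 1) => A) ab.1 ≫ biproduct.ι (fun _ : Fin (n + 1) => A) ab.2) := by
  simp_rw [biproduct.map_π_assoc, Category.assoc]
  calc φ = (∑ a, biproduct.π (fun _ : Fin (n + 1) => A) a ≫ biproduct.ι (fun _ : Fin (n + 1) => A) a) ≫ φ ≫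
        (∑ b, biproduct.π (fun _ : Fin (n + 1) => A) b ≫ biproduct.ι (fun _ : Fin (n + 1) => A) b) := by
        rw [biproduct.total, Category.id_comp, Category.comp_id]
    _ = ∑ a, ∑ b, biproduct.π (fun _ : Fin (n + 1) => A) a ≫ biproduct.ι (fun _ : Fin (n + 1) => A) a ≫ φ ≫
        biproduct.π (fun _ : Fin (n + 1) => A) b ≫ biproduct.ι (fun _ : Fin (n + 1) => A) b := by
        rw [Preadditive.sum_comp]
        refine Finset.sum_congr rfl fun a _ ↦ ?_
        rw [Category.assoc, Preadditive.comp_sum, Preadditive.comp_sum, Preadditive.comp_sum]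
    _ = ∑ ab : Fin (n + 1) × Fin (n + 1), biproduct.π (fun _ : Fin (n + 1) => A) ab.1 ≫
        biproduct.ι (fun _ : Fin (n + 1) => A) ab.1 ≫ φ ≫ biproduct.π (fun _ : Fin (n + 1) => A) ab.2 ≫
          biproduct.ι (fun _ : Fin (n + 1) => A) ab.2 :=
        (Fintype.sum_prod_type fun ab : Fin (n + 1) × Fin (n + 1) ↦ biproduct.π (fun _ : Fin (n + 1) => A) ab.1 ≫
          biproduct.ι (fun _ : Fin (n + 1) => A) ab.1 ≫ φ ≫ biproduct.π (fun _ : Fin (n + 1) => A) ab.2 ≫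
            biproduct.ι (fun _ : Fin (n + 1) => A) ab.2).symm

/-- … hence on `H¹(A^{n+1})`: `φ^* = Σ_{a,b} (⊕φ_{ab})^* ∘ (πₐ ≫ ι_b)^*` — `φ^*` is the matrix of the `φ_{ab}^*` in the matrix
units `e_{ab} = (πₐ ≫ ι_b)^*`. [cite: LangeBirkenhake1992, §1.1] [cite: McconnellRobson2001, 3.5.5–3.5.6] -/
theorem pullbackOne_eq_sum_biproductMap_entry_mul_π_comp_ι
    (φ : ⨁ (fun _ : Fin (n + 1) => A) ⟶ ⨁ (fun _ : Fin (n + 1) => A)) :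
    pullbackOne (⨁ (fun _ : Fin (n + 1) => A)) φ = ∑ ab : Fin (n + 1) × Fin (n + 1),
      pullbackOne (⨁ (fun _ : Fin (n + 1) => A)) (biproduct.map fun _ : Fin (n + 1) =>
          biproduct.ι (fun _ : Fin (n + 1) => A) ab.1 ≫ φ ≫ biproduct.π (fun _ : Fin (n + 1) => A) ab.2) *
        pullbackOne (⨁ (fun _ : Fin (n + 1) => A))
          (biproduct.π (fun _ : Fin (n + 1) => A) ab.1 ≫ biproduct.ι (fun _ : Fin (n + 1) => A) ab.2) := by
  conv_lhs => rw [eq_sum_biproductMap_entry_comp_π_comp_ι φ, pullbackOne_finset_sum]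
  exact Finset.sum_congr rfl fun ab _ ↦ pullbackOne_comp_eq_mul' _ _

/-- **A MATRIX OF POLYNOMIALS IN `ψ` LIES IN `ℂ⟨(⊕ψ)^*, e_{ab}⟩`.** If every entry of `φ ∈ End(A^{n+1})` is a polynomial in
`ψ`, `ιₐ ≫ φ ≫ π_b = p_{ab}(ψ)` with `p_{ab} ∈ ℤ[X]` — i.e. `φ ∈ M_{n+1}(ℤ[ψ]) ⊆ M_{n+1}(E) = B`, `E = ℚ(ψ)` — then
`φ^* = Σ_{a,b} p̄_{ab}((⊕ψ)^*) e_{ab}` lies in the complex algebra generated by the diagonal `(⊕ψ)^*` and the matrix units: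
the hypothesis `hF` of `weilClassesField_biproduct_le_divisorClassesSpan_of_mem_adjoin_diagonal`, discharged from the
matrix entries. [cite: MoonenZarhin1998WeilClasses, §1 Table 1 and proof of Criterion (2) («F ⊆ B = M_m(E)»; chunk p0002 L60–L84, p0003 L82–L90)]
[cite: McconnellRobson2001, 3.5.5–3.5.7] -/
theorem pullbackOne_mem_adjoin_diagonal_of_entry_eq_eval₂ (p : Fin (n + 1) → Fin (n + 1) → Polynomial ℤ)
    (hφ : ∀ a b, biproduct.ι (fun _ : Fin (n + 1) => A) a ≫ φ ≫ biproduct.π (fun _ : Fin (n + 1) => A) b =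
      Polynomial.eval₂ (Int.castRingHom (CategoryTheory.End A)) (ψ : CategoryTheory.End A) (p a b)) :
    pullbackOne (⨁ (fun _ : Fin (n + 1) => A)) φ ∈ Algebra.adjoin ℂ
      (insert (pullbackOne (⨁ (fun _ : Fin (n + 1) => A)) (biproduct.map fun _ : Fin (n + 1) => ψ))
        (Set.range fun ab : Fin (n + 1) × Fin (n + 1) ↦ pullbackOne (⨁ (fun _ : Fin (n + 1) => A))
          (biproduct.π (fun _ : Fin (n + 1) => A) ab.1 ≫ biproduct.ι (fun _ : Fin (n + 1) => A) ab.2))) := by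
  rw [pullbackOne_eq_sum_biproductMap_entry_mul_π_comp_ι φ]
  refine Subalgebra.sum_mem _ fun ab _ ↦ Subalgebra.mul_mem _ ?_ (Algebra.subset_adjoin (Set.mem_insert_of_mem _ ⟨ab, rfl⟩))
  rw [hφ ab.1 ab.2, pullbackOne_biproductMap_const_eval₂]
  exact Algebra.adjoin_mono (Set.singleton_subset_iff.2 (Set.mem_insert _ _)) (Polynomial.aeval_mem_adjoin_singleton ℂ _)

/-- **THE TYPE-1 ROW, EXPLICIT FORM: `W_F(A^{n+1})` IS DECOMPOSABLE FOR `F = ℚ(φ)`, `φ` ANY MATRIX OF POLYNOMIALS IN THE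
REAL MULTIPLICATION `ψ`.** `A` of positive dimension with `h ∈ B¹ ⊗ ℂ`, `h^{dim} ≠ 0`, `Q_h` non-degenerate; `ψ^*`
`Q_h`-symmetric with `Q(ψ) = 0`, `Q ∈ ℤ[T]` monic irreducible over `ℚ`; `φ ∈ End(A^{n+1})` with entries
`ιₐ ≫ φ ≫ π_b = p_{ab}(ψ)`, `p_{ab} ∈ ℤ[X]`, and `P(φ) = 0`, `P` monic irreducible of degree `e`, `e · 2m = 2(n+1) dim A`:
then `W_F ⊗ ℂ ≤ 𝒟ᵐ ⊗ ℂ` for the product polarization (`pullbackOne_mem_adjoin_diagonal_of_entry_eq_eval₂` +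
`weilClassesField_biproduct_le_divisorClassesSpan_of_mem_adjoin_diagonal`). Integral entries are no restriction for the
field `F = ℚ(φ) = ℚ(Nφ)`. [cite: MoonenZarhin1998WeilClasses, §1 Criterion (2) and its proof, type 1 (chunk p0003 L46–L90)]
[cite: Milne1999LefschetzClasses, §1 p. 643, Thm. 3.2, Cor. 4.5] -/
theorem weilClassesField_biproduct_le_divisorClassesSpan_of_entry_eq_eval₂ (hA : 0 < A.dim)
    (hh : h ∈ hodgeClassSpan A.dim A.X 1) (htop : lefschetzPow h (A.dim - 1) 2 h ≠ 0)
    (hnd : ∀ x : complexBetti A.X 1, (∀ y, polarizationPairingOne A.X h (A.dim - 1) x y = 0) → x = 0)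
    (hψsym : ∀ v w : complexBetti A.X 1, polarizationPairingOne A.X h (A.dim - 1) (pullbackOne A ψ v) w =
      polarizationPairingOne A.X h (A.dim - 1) v (pullbackOne A ψ w))
    (hQm : Q.Monic) (hQirr : Irreducible (Q.map (Int.castRingHom ℚ)))
    (hψQ : Polynomial.eval₂ (Int.castRingHom (CategoryTheory.End A)) (ψ : CategoryTheory.End A) Q = 0)
    (hPm : P.Monic) (hPe : P.natDegree = e) (hPirr : Irreducible (P.map (Int.castRingHom ℚ)))
    (hφ : Polynomial.eval₂ (Int.castRingHom (CategoryTheory.End (⨁ (fun _ : Fin (n + 1) => A))))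
      (φ : CategoryTheory.End (⨁ (fun _ : Fin (n + 1) => A))) P = 0)
    (her : e * (2 * m) = 2 * ((n + 1) * A.dim)) (p : Fin (n + 1) → Fin (n + 1) → Polynomial ℤ)
    (hφp : ∀ a b, biproduct.ι (fun _ : Fin (n + 1) => A) a ≫ φ ≫ biproduct.π (fun _ : Fin (n + 1) => A) b =
      Polynomial.eval₂ (Int.castRingHom (CategoryTheory.End A)) (ψ : CategoryTheory.End A) (p a b)) :
    weilClassesField (⨁ (fun _ : Fin (n + 1) => A)) φ P (2 * m) ≤
      divisorClassesSpan (⨁ (fun _ : Fin (n + 1) => A)).X (⨁ (fun _ : Fin (n + 1) => A)).dim m :=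
  weilClassesField_biproduct_le_divisorClassesSpan_of_mem_adjoin_diagonal hA hh htop hnd hψsym hQm hQirr hψQ hPm hPe
    hPirr hφ her (pullbackOne_mem_adjoin_diagonal_of_entry_eq_eval₂ p hφp)

/-- **… and `W_F ⊗ ℂ ≤ algebraicClasses`: THE WEIL CLASSES OF `ℚ(φ)`, `φ` ANY MATRIX OF POLYNOMIALS IN THE REAL MULTIPLICATION
`ψ` ON `A^{n+1}`, ARE ALGEBRAIC** (Lefschetz `(1,1)`, the tree's `lefschetzOneOne_rational_holds`).
[cite: MoonenZarhin1998WeilClasses, Introduction (chunk p0001 L10–L18) and §1 Criterion (2) (chunk p0003 L46–L90)] [cite: VoisinHodgeI2002, Thm. 11.30] -/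
theorem weilClassesField_biproduct_le_algebraicClasses_of_entry_eq_eval₂ (hA : 0 < A.dim)
    (hh : h ∈ hodgeClassSpan A.dim A.X 1) (htop : lefschetzPow h (A.dim - 1) 2 h ≠ 0)
    (hnd : ∀ x : complexBetti A.X 1, (∀ y, polarizationPairingOne A.X h (A.dim - 1) x y = 0) → x = 0)
    (hψsym : ∀ v w : complexBetti A.X 1, polarizationPairingOne A.X h (A.dim - 1) (pullbackOne A ψ v) w =
      polarizationPairingOne A.X h (A.dim - 1) v (pullbackOne A ψ w))
    (hQm : Q.Monic) (hQirr : Irreducible (Q.map (Int.castRingHom ℚ)))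
    (hψQ : Polynomial.eval₂ (Int.castRingHom (CategoryTheory.End A)) (ψ : CategoryTheory.End A) Q = 0)
    (hPm : P.Monic) (hPe : P.natDegree = e) (hPirr : Irreducible (P.map (Int.castRingHom ℚ)))
    (hφ : Polynomial.eval₂ (Int.castRingHom (CategoryTheory.End (⨁ (fun _ : Fin (n + 1) => A))))
      (φ : CategoryTheory.End (⨁ (fun _ : Fin (n + 1) => A))) P = 0)
    (her : e * (2 * m) = 2 * ((n + 1) * A.dim)) (p : Fin (n + 1) → Fin (n + 1) → Polynomial ℤ)
    (hφp : ∀ a b, biproduct.ι (fun _ : Fin (n + 1) => A) a ≫ φ ≫ biproduct.π (fun _ : Fin (n + 1) => A) b =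
      Polynomial.eval₂ (Int.castRingHom (CategoryTheory.End A)) (ψ : CategoryTheory.End A) (p a b)) :
    weilClassesField (⨁ (fun _ : Fin (n + 1) => A)) φ P (2 * m) ≤ algebraicClasses (⨁ (fun _ : Fin (n + 1) => A)).X m :=
  weilClassesField_biproduct_le_algebraicClasses_of_mem_adjoin_diagonal hA hh htop hnd hψsym hQm hQirr hψQ hPm hPe
    hPirr hφ her (pullbackOne_mem_adjoin_diagonal_of_entry_eq_eval₂ p hφp)

end MatrixEntries

end Literature.AlgebraicGeometry.HodgeTheory

end
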